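import Mathlib
import Literature.AlgebraicGeometry.Resolution.RegularLocalRingsProofs
import HarnessLib

set_option linter.dupNamespace false -- mandated namespace of this single-conjunct summit

/-!
# A regular finite height-one hull in the F-finite case

Let `R` be a regular local ring of prime characteristic `p` whose Frobenius endomorphism
`F : R → R`, `r ↦ r ^ p`, is a finite ring map, and let `f ∈ R`.  Then there is a regular local
ring `R'`, finite and injective over `R`, with `R' ^ p ⊆ R` and containing a `p`-th root of `f`.

Proof.  Take `R' := R`, viewed as an `R`-algebra through Frobenius.  Then `Module.Finite R R'` is
the hypothesis `F.Finite`; the structure map `F` is injective because a regular local ring is a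
domain (Matsumura, Thm. 14.3, `isDomain_of_isRegularLocalRing` in the tree), hence reduced; every
`r' ∈ R'` satisfies `F r' = r' ^ p`; and `t := f` is a `p`-th root of `F f = f ^ p`.
-/

namespace Summit.ResolutionOfSingularities.ResolutionOfSingularities.Theorems.Picover.HeightOneHull

/-- **F-finite height-one hull.**  If `R` is a regular local ring of prime characteristic `p` with
finite Frobenius, then for every `f ∈ R` there is a regular local `R`-algebra `R'`, module-finite
over `R` with injective structure map, such that every `p`-th power of `R'` comes from `R` and `f`
acquires a `p`-th root in `R'` (namely `R' := R` with structure map the Frobenius). -/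
theorem exists_regular_heightOne_hull_of_frobenius_finite : ∀ (p : ℕ) [Fact p.Prime] (R : Type) [CommRing R] [IsRegularLocalRing R] [CharP R p], (frobenius R p).Finite → ∀ f : R, ∃ (R' : Type) (_ : CommRing R') (_ : IsRegularLocalRing R') (_ : Algebra R R'), Module.Finite R R' ∧ Function.Injective (algebraMap R R') ∧ (∀ r' : R', ∃ r : R, algebraMap R R' r = r' ^ p) ∧ ∃ t : R', t ^ p = algebraMap R R' f := by
  intro p _ R _ _ _ hF f
  haveI : IsDomain R := Literature.AlgebraicGeometry.Resolution.isDomain_of_isRegularLocalRing R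
  refine ⟨R, inferInstance, inferInstance, (frobenius R p).toAlgebra, hF, ?_, fun r' => ⟨r', ?_⟩,
    f, ?_⟩
  · rw [RingHom.algebraMap_toAlgebra]
    exact frobenius_inj R p
  · rw [RingHom.algebraMap_toAlgebra, frobenius_def]
  · rw [RingHom.algebraMap_toAlgebra, frobenius_def]

end Summit.ResolutionOfSingularities.ResolutionOfSingularities.Theorems.Picover.HeightOneHull
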